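import Summits.HodgeConjecture.HodgeConjecture.Theorems.VHCAbelianSchemesRoadDiagonalTail
import HarnessLib

/-!
# Road b02 (`VHCAbelianSchemesRoad`, D-0059) — ONE diagonal cell `(2m, m)` serves every pencil below it; node (U), row b02 and
# `HC_AV` from regime 2 at INFINITELY MANY diagonal cells (the weakest statement of this shape the road consumes)

research route conditional on HC_CM; not a corollary; Q11.4-sentence-2 already refuted in dim ≥ 3.
(cell line of seat ab-andre-2: research route, not a corollary; conditional on HC_CM plus one named minimal statement.)

THEOREMS ONLY (no definition, no named fact, no sorry; `HC_CM` occurs nowhere; no cell of the crux is claimed). Seat ab-andre-2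
gen 56, PART Y-b (sequel of `VHCAbelianSchemesRoadDiagonalTail.lean`, the TAIL engine).

WHAT THIS FILE PROVES. The SINGLE-CELL engine ABOVE THE THRESHOLD: on a one-parameter abelian scheme of relative dimension `n`
(affine curve base, section, quasi-projective total space) a fibrewise rational `(p, p)` global class `W`, algebraic at one fibre,
has an UNCOUNTABLE algebraicity locus as soon as the door holds and the graded crux K-SR♭∃ holds at ONE diagonal cell `(2m, m)`
with `m ≥ max(p, n − p)` — part X-d (`VHCAbelianSchemesRoadDiagonalCell.lean`, p450442, `not_countable_algebraicityLocus_of_cell`)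
had the EXACT cell `m = max(p, n − p)` only (§§1–2: lower shadow if `2p > n`; pure padding `𝒳 × B₁`, `dim B₁ = m + p − n`,
part Y-a; middle lift `× B₂`, `dim B₂ = m − p`; the cell; the door — all loci coincide as sets; X-d's file is not imported, it
imports the route file). Hence (§3) node (U), row b02 and `HC_AV` — and the
`closes`-shape of the road over the twisted door — from regime 2 at INFINITELY MANY diagonal cells
(`∀ M, ∃ m ≥ M, cell (2m, m)`), FACT-FREE, no class target, no `HC_CM`. Every tail `m ≥ M₀` (part Y-a) is such a set; so is
every sparse infinite set (`m = 10, 100, 1000, …`). For the road: the option-(α) crux «all diagonal cells `m ≥ 2`» is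
consumed only through «infinitely many of them»; no finite set of cells is shown to suffice (and none is load-bearing).

References: [BrosnanFangNiePearlstein2009] §6 Lemma 48; [Fulton1998] §10.1 Cor. 10.1; [Lieberman1968]; [CharlesSchnell2014Notes]
Conj. 11.3.1, Prop. 11.3.11; [KerrPearlstein2011] §3.1; [Andre1996Motifs] §6.3; [GortzWedhorn2023] Thm. 27.291;
[BuchweitzFlenner2003] §5 Thm. 5.1; [Pridham2024Semiregularity] Cor. 2.25, Rem. 2.27.
-/

noncomputable section

open CategoryTheory CategoryTheory.Limits AlgebraicGeometry Topology MonoidalCategory CartesianMonoidalCategory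

namespace Summit.HodgeConjecture.HodgeConjecture.Ring2.SemiregularRepresentatives

set_option linter.dupNamespace false -- the cell's namespace repeats the summit name, as in every `Ring2*` file

open Literature.AlgebraicGeometry Literature.AlgebraicGeometry.Motives Literature.AlgebraicGeometry.HodgeTheory
open Literature.AlgebraicTopology.SingularHomology
open Literature.AlgebraicGeometry.Andre1996 (andre1996_cmAnchoredPencil
  andre1996_cmHodgeClasses_algebraicallyAnchoredPencils)
open Summit.Ventures.HSemireg (ObjClass LocalVariationalHodgeFor)
open Summit.HodgeConjecture.HodgeConjecture.Ring2.Hypotheses (AbelianSchemeVHC)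
open Summit.HodgeConjecture.HodgeConjecture.Ring2.Binders
open Summit.HodgeConjecture.HodgeConjecture.Ring2.ClassTargets

variable {𝒳 S : SchemeOver ℂ}

/-! ## §1 The single-cell engine in the lower half `2p ≤ n` -/

/-- **One cell, lower half, exact fit `n = m + p`**: for `2p ≤ n` the cell `(2(n − p), n − p)` of the graded crux and the door
give the conclusion of node (U) at `(n, p)` per pencil (the pencil itself if `2p = n`, else the middle lift by `B` of dimension
`n − 2p`; part X-a §3 with ONE cell in place of a tail). [cite: BrosnanFangNiePearlstein2009, §6 Lemma 48]
[cite: Lieberman1968, main theorem] [cite: BuchweitzFlenner2003, §5 Thm. 5.1] -/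
theorem not_countable_algebraicityLocus_of_cellFit_of_lowerHalf {𝒪 : ObjClass} (hT : LocalVariationalHodgeFor 𝒪) {m : ℕ}
    (hSR : AdmissibleRepresentativesLefAtDeg 𝒪 (2 * m) m)
    (f : 𝒳 ⟶ S) {n : ℕ} (hf : IsSmoothProjectiveFamily f n) (h𝒳 : IsQuasiProjectiveOver 𝒳)
    [IrreducibleSpace S.left] [IsAffine S.left] [AlgebraicGeometry.Smooth S.hom] (hdim : topologicalKrullDim S.left = 1)
    (habel : ∀ s : ComplexPoints S, ∃ A' : AbelianVariety ℂ, A'.dim = n ∧ Nonempty (A'.X ≅ fiberOver f s))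
    (he : ∃ e : S ⟶ 𝒳, e ≫ f = 𝟙 S) {p : ℕ} (hpn : 2 * p ≤ n) (hm : m + p = n) (W : complexBetti 𝒳 (2 * p))
    (hW : ∀ s : ComplexPoints S, IsRationalClass (complexBetti.map (fiberι f s) (2 * p) W) ∧
      IsOfHodgeType n (fiberOver f s) (2 * p) p p (complexBetti.map (fiberι f s) (2 * p) W))
    {s₀ : ComplexPoints S} (hs₀ : complexBetti.map (fiberι f s₀) (2 * p) W ∈ algebraicClasses (fiberOver f s₀) p) :
    ¬ {s : ComplexPoints S |
        complexBetti.map (fiberι f s) (2 * p) W ∈ algebraicClasses (fiberOver f s) p}.Countable := by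
  haveI : LocallyOfFiniteType S.hom := inferInstance
  haveI : IsSeparated S.hom := (IsQuasiProjectiveOver.of_isAffine S).isSeparated
  rcases Nat.eq_or_lt_of_le hpn with hmid | hlt
  · -- already in the middle: the cell `(2p, p)` of the pencil itself
    have hmp : m = p := by omega
    subst hmp
    subst hmid
    exact not_countable_algebraicityLocus_of_lefAtDeg hT hSR f hf h𝒳 hdim habel he W hW hs₀
  · -- pad by `B`, `dim B = n - 2p ≥ 1`, and lift `W` to the middle of `𝒳 × B ⟶ S`
    obtain ⟨B, hB⟩ := exists_abelianVariety_dim_eq_succ ℂ (n - 2 * p - 1)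
    have hpB : 2 * p + B.dim = n := by omega
    obtain ⟨hf', habel', W', hW', hiff⟩ := exists_middleLift f hf h𝒳 habel B hpB W hW
    have hmid : n + B.dim = 2 * (p + B.dim) := by omega
    have hmB : p + B.dim = m := by omega
    subst hmB
    rw [hmid] at hf' habel' hW'
    have h := not_countable_algebraicityLocus_of_lefAtDeg hT hSR (fst 𝒳 B.X ≫ f) hf'
      (isQuasiProjectiveOver_tensor h𝒳 (AbelianVariety.isSmoothProjective_holds (A := B)).isProjectiveOver) hdim habel'
      (exists_section_fst_comp f he B) W' hW' ((hiff s₀).2 hs₀)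
    have hset : {s : ComplexPoints S | complexBetti.map (fiberι (fst 𝒳 B.X ≫ f) s) (2 * (p + B.dim)) W' ∈
          algebraicClasses (fiberOver (fst 𝒳 B.X ≫ f) s) (p + B.dim)} =
        {s : ComplexPoints S | complexBetti.map (fiberι f s) (2 * p) W ∈ algebraicClasses (fiberOver f s) p} :=
      Set.ext fun s => hiff s
    rwa [hset] at h

/-- **One cell, lower half: ANY cell `(2m, m)` with `m ≥ n − p` serves `(n, p)`, `2p ≤ n`** — pure padding by `B₁` of dimension
`m + p − n` (part Y-a `exists_purePadding`: same codimension, same locus) reaches the exact fit `m + p = n + dim B₁` of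
`not_countable_algebraicityLocus_of_cellFit_of_lowerHalf`. [cite: Fulton1998, §10.1 Cor. 10.1] [cite: BrosnanFangNiePearlstein2009, §6 Lemma 48]
[cite: Lieberman1968, main theorem] -/
theorem not_countable_algebraicityLocus_of_cellAbove_of_lowerHalf {𝒪 : ObjClass} (hT : LocalVariationalHodgeFor 𝒪) {m : ℕ}
    (hSR : AdmissibleRepresentativesLefAtDeg 𝒪 (2 * m) m)
    (f : 𝒳 ⟶ S) {n : ℕ} (hf : IsSmoothProjectiveFamily f n) (h𝒳 : IsQuasiProjectiveOver 𝒳)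
    [IrreducibleSpace S.left] [IsAffine S.left] [AlgebraicGeometry.Smooth S.hom] (hdim : topologicalKrullDim S.left = 1)
    (habel : ∀ s : ComplexPoints S, ∃ A' : AbelianVariety ℂ, A'.dim = n ∧ Nonempty (A'.X ≅ fiberOver f s))
    (he : ∃ e : S ⟶ 𝒳, e ≫ f = 𝟙 S) {p : ℕ} (hpn : 2 * p ≤ n) (hm : n ≤ m + p) (W : complexBetti 𝒳 (2 * p))
    (hW : ∀ s : ComplexPoints S, IsRationalClass (complexBetti.map (fiberι f s) (2 * p) W) ∧
      IsOfHodgeType n (fiberOver f s) (2 * p) p p (complexBetti.map (fiberι f s) (2 * p) W))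
    {s₀ : ComplexPoints S} (hs₀ : complexBetti.map (fiberι f s₀) (2 * p) W ∈ algebraicClasses (fiberOver f s₀) p) :
    ¬ {s : ComplexPoints S |
        complexBetti.map (fiberι f s) (2 * p) W ∈ algebraicClasses (fiberOver f s) p}.Countable := by
  rcases Nat.eq_or_lt_of_le hm with heq | hlt
  · exact not_countable_algebraicityLocus_of_cellFit_of_lowerHalf hT hSR f hf h𝒳 hdim habel he hpn heq.symm W hW hs₀
  · -- pad upwards by `B₁`, `dim B₁ = m + p - n ≥ 1`: same codimension, same locus
    obtain ⟨B, hB⟩ := exists_abelianVariety_dim_eq_succ ℂ (m + p - n - 1)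
    have hmB : m + p = n + B.dim := by omega
    obtain ⟨hf', habel', W', hW', hiff⟩ := exists_purePadding f hf habel B p W hW
    have h := not_countable_algebraicityLocus_of_cellFit_of_lowerHalf hT hSR (fst 𝒳 B.X ≫ f) hf'
      (isQuasiProjectiveOver_tensor h𝒳 (AbelianVariety.isSmoothProjective_holds (A := B)).isProjectiveOver) hdim habel'
      (exists_section_fst_comp f he B) (by omega) hmB W' hW' ((hiff s₀).2 hs₀)
    have hset : {s : ComplexPoints S | complexBetti.map (fiberι (fst 𝒳 B.X ≫ f) s) (2 * p) W' ∈
          algebraicClasses (fiberOver (fst 𝒳 B.X ≫ f) s) p} =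
        {s : ComplexPoints S | complexBetti.map (fiberι f s) (2 * p) W ∈ algebraicClasses (fiberOver f s) p} :=
      Set.ext fun s => hiff s
    rwa [hset] at h

/-! ## §2 The single-cell engine in every codimension -/

/-- **THE SINGLE-CELL ENGINE.** On a one-parameter abelian scheme of relative dimension `n` (affine curve base, section,
quasi-projective total space), a fibrewise rational `(p, p)` global class `W` algebraic at one fibre has an uncountable
algebraicity locus as soon as the door holds and the graded crux holds at ONE diagonal cell `(2m, m)` with `m ≥ p` and
`m ≥ n − p`: above the middle the lower shadow of codimension `n − p` first (Lieberman's `B(A)` on the fibres); beyond `p > n`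
there are no non-zero `(p, p)`-classes. [cite: KerrPearlstein2011, §3.1] [cite: Lieberman1968, main theorem]
[cite: BrosnanFangNiePearlstein2009, §6 Lemma 48] [cite: Fulton1998, §10.1 Cor. 10.1] -/
theorem not_countable_algebraicityLocus_of_cellAbove {𝒪 : ObjClass} (hT : LocalVariationalHodgeFor 𝒪) {m : ℕ}
    (hSR : AdmissibleRepresentativesLefAtDeg 𝒪 (2 * m) m)
    (f : 𝒳 ⟶ S) {n : ℕ} (hf : IsSmoothProjectiveFamily f n) (h𝒳 : IsQuasiProjectiveOver 𝒳)
    [IrreducibleSpace S.left] [IsAffine S.left] [AlgebraicGeometry.Smooth S.hom] (hdim : topologicalKrullDim S.left = 1)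
    (habel : ∀ s : ComplexPoints S, ∃ A' : AbelianVariety ℂ, A'.dim = n ∧ Nonempty (A'.X ≅ fiberOver f s))
    (he : ∃ e : S ⟶ 𝒳, e ≫ f = 𝟙 S) {p : ℕ} (hpm : p ≤ m) (hnm : n ≤ m + p) (W : complexBetti 𝒳 (2 * p))
    (hW : ∀ s : ComplexPoints S, IsRationalClass (complexBetti.map (fiberι f s) (2 * p) W) ∧
      IsOfHodgeType n (fiberOver f s) (2 * p) p p (complexBetti.map (fiberι f s) (2 * p) W))
    {s₀ : ComplexPoints S} (hs₀ : complexBetti.map (fiberι f s₀) (2 * p) W ∈ algebraicClasses (fiberOver f s₀) p) :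
    ¬ {s : ComplexPoints S |
        complexBetti.map (fiberι f s) (2 * p) W ∈ algebraicClasses (fiberOver f s) p}.Countable := by
  haveI : LocallyOfFiniteType S.hom := inferInstance
  by_cases hpn : 2 * p ≤ n
  · exact not_countable_algebraicityLocus_of_cellAbove_of_lowerHalf hT hSR f hf h𝒳 hdim habel he hpn hnm W hW hs₀
  by_cases hnp : n < p
  · -- no non-zero `(p,p)`-classes: every fibre is algebraic
    have huniv : {s : ComplexPoints S |
        complexBetti.map (fiberι f s) (2 * p) W ∈ algebraicClasses (fiberOver f s) p} = Set.univ :=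
      Set.eq_univ_of_forall fun s => by
        rw [Set.mem_setOf_eq, (hW s).2.eq_zero_pp_of_lt hnp]
        exact Submodule.zero_mem _
    rw [huniv]
    exact not_countable_of_isOpen_of_curve hdim isOpen_univ ⟨s₀, Set.mem_univ _⟩
  · -- above the middle: the lower shadow of codimension `n - p`, then §1 (`n ≤ m + (n - p)` iff `p ≤ m`)
    obtain ⟨q, j, hqj, hp⟩ : ∃ q j : ℕ, 2 * q + j = n ∧ q + j = p := ⟨n - p, 2 * p - n, by omega, by omega⟩
    subst hp
    obtain ⟨W', hW', hiff⟩ := exists_lowerShadow f hf h𝒳 (IsQuasiProjectiveOver.of_isAffine S) ‹_› habel hqj W hW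
    have h := not_countable_algebraicityLocus_of_cellAbove_of_lowerHalf hT hSR f hf h𝒳 hdim habel he (p := q) (by omega)
      (by omega) W' hW' ((hiff s₀).2 hs₀)
    have hset : {s : ComplexPoints S | complexBetti.map (fiberι f s) (2 * q) W' ∈ algebraicClasses (fiberOver f s) q} =
        {s : ComplexPoints S | complexBetti.map (fiberι f s) (2 * (q + j)) W ∈
          algebraicClasses (fiberOver f s) (q + j)} :=
      Set.ext fun s => hiff s
    rwa [hset] at h

/-! ## §3 The nodes from INFINITELY MANY diagonal cells — no class target, no `HC_CM` -/

/-- **Node (U) from the door and regime K-SR♭∃ at INFINITELY MANY diagonal cells `(2m, m)` of the graded crux** — FACT-FREE: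
a pencil of relative dimension `n` with a class of codimension `p` is served by any cell with `m ≥ n + p`.
[cite: CharlesSchnell2014Notes, Conj. 11.3.1 and Prop. 11.3.11 (proof)] [cite: BrosnanFangNiePearlstein2009, §6 Lemma 48]
[cite: Fulton1998, §10.1 Cor. 10.1] -/
theorem oneParameterAbelianSchemeVHCUncountable_of_lefAtDeg_diagonal_frequently {𝒪 : ObjClass}
    (hT : LocalVariationalHodgeFor 𝒪) (hSR : ∀ M : ℕ, ∃ m : ℕ, M ≤ m ∧ AdmissibleRepresentativesLefAtDeg 𝒪 (2 * m) m) :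
    OneParameterAbelianSchemeVHCUncountable := by
  intro n 𝒳 S f hf h𝒳 hirr haff hsm hdim habel he p W hW s₀ hs₀
  haveI := hirr
  haveI := haff
  haveI := hsm
  obtain ⟨m, hm, hcell⟩ := hSR (n + p)
  exact not_countable_algebraicityLocus_of_cellAbove hT hcell f hf h𝒳 hdim habel he (by omega) (by omega) W hW hs₀

/-- A tail `m ≥ M₀` of cells is an infinite set of cells (bookkeeping between parts Y-a and Y-b). [folklore] -/
theorem frequently_of_tail {𝒪 : ObjClass} (M₀ : ℕ) (hSR : ∀ m : ℕ, M₀ ≤ m → AdmissibleRepresentativesLefAtDeg 𝒪 (2 * m) m) :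
    ∀ M : ℕ, ∃ m : ℕ, M ≤ m ∧ AdmissibleRepresentativesLefAtDeg 𝒪 (2 * m) m :=
  fun M => ⟨max M M₀, le_max_left _ _, hSR _ (le_max_right _ _)⟩

/-- **Row b02 from the door, infinitely many diagonal cells and the curve residual — no class target, no `HC_CM`.**
[cite: CharlesSchnell2014Notes, Prop. 11.3.11 (proof)] [cite: GortzWedhorn2023, Thm. 27.291] -/
theorem abelianSchemeVHC_of_lefAtDeg_diagonal_frequently {𝒪 : ObjClass} (hT : LocalVariationalHodgeFor 𝒪)
    (hSR : ∀ M : ℕ, ∃ m : ℕ, M ≤ m ∧ AdmissibleRepresentativesLefAtDeg 𝒪 (2 * m) m)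
    (hqp : OneParameterAbelianSchemeQuasiProjective) : AbelianSchemeVHC :=
  abelianSchemeVHC_of_uncountable_of_oneParameterAbelianSchemeQuasiProjective hqp
    (oneParameterAbelianSchemeVHCUncountable_of_lefAtDeg_diagonal_frequently hT hSR)

/-- **`HC_AV` from the door, regime K-SR♭∃ at INFINITELY MANY diagonal cells, the curve residual and André 1996 #21/#22** — no
class target, no `HC_CM`; the weakest diagonal statement the road's engine consumes (every tail, part Y-a, is an instance).
[cite: Andre1996Motifs, §6.3 Lemmes 6.3.1–6.3.3 and Remarque 2 (p. 33)] [cite: BrosnanFangNiePearlstein2009, §6 Lemma 48]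
[cite: Fulton1998, §10.1 Cor. 10.1] -/
theorem hc_av_of_lefAtDeg_diagonal_frequently {𝒪 : ObjClass} (hT : LocalVariationalHodgeFor 𝒪)
    (hSR : ∀ M : ℕ, ∃ m : ℕ, M ≤ m ∧ AdmissibleRepresentativesLefAtDeg 𝒪 (2 * m) m)
    (hqp : OneParameterAbelianSchemeQuasiProjective) (h₂₁ : andre1996_cmAnchoredPencil)
    (h₂₂ : andre1996_cmHodgeClasses_algebraicallyAnchoredPencils) :
    Theses.PadicSemiregularLift.HodgeAbelianVarieties :=
  (Ring2.Deform.HC_AV_iff_abelianSchemeVHC_of_andre1996 h₂₁ h₂₂).mpr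
    (abelianSchemeVHC_of_lefAtDeg_diagonal_frequently hT hSR hqp)

/-- **`HC_AV` in the `closes`-shape of road b02 with the crux REPLACED by «regime 2 over the twisted door at infinitely many
diagonal cells», per Chern character theory** (`∀ C M, ∃ m ≥ M, LefAtExceptionalRegimeAt (twisted door C) (2m) m`) — K-C, the
twisted door, Raynaud, André #21/#22 as in `Theses.VHCAbelianSchemesRoad.closes`; no class target, no `HC_CM`.
[cite: Andre1996Motifs, §6.3 Lemmes 6.3.1–6.3.3] [cite: BrosnanFangNiePearlstein2009, §6 Lemma 48]
[cite: Pridham2024Semiregularity, Cor. 2.25 and Rem. 2.27] [cite: GortzWedhorn2023, Thm. 27.291] [cite: Fulton1998, §10.1 Cor. 10.1] -/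
theorem hc_av_of_exceptionalRegimeAt_twisted_diagonal_frequently (hC : ChernCharacterOnBetti)
    {Adm : PerfectAdmissibility} (hAdm : ∀ n X₀ I E, bfSingleAdmissible n X₀ I E → Adm n X₀ I E)
    (hDiag : ∀ (C : ChernCharacterBetti) (M : ℕ), ∃ m : ℕ, M ≤ m ∧
      LefAtExceptionalRegimeAt (twistedReflexiveClass C Adm) (2 * m) m)
    (hDoor : ∀ C : ChernCharacterBetti, TwistedPerfectDoorVHC C Adm)
    (hR : raynaud1970_abelianScheme_section_projective) (h₂₁ : andre1996_cmAnchoredPencil)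
    (h₂₂ : andre1996_cmHodgeClasses_algebraicallyAnchoredPencils) :
    Theses.PadicSemiregularLift.HodgeAbelianVarieties := by
  obtain ⟨C⟩ := hC
  refine hc_av_of_lefAtDeg_diagonal_frequently (𝒪 := twistedReflexiveClass C Adm) (hDoor C) (fun M => ?_)
    (oneParameterAbelianSchemeQuasiProjective_of_raynaud1970 hR) h₂₁ h₂₂
  obtain ⟨m, hm, h⟩ := hDiag C M
  exact ⟨m, hm, admissibleRepresentativesLefAtDeg_twisted_of_exceptionalRegimeAt C hAdm h⟩

/-! ## Audit: fact-free (closures are the three standard axioms; no named fact, no `HC_CM`, no class target) -/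

#print axioms Summit.HodgeConjecture.HodgeConjecture.Ring2.SemiregularRepresentatives.not_countable_algebraicityLocus_of_cellAbove
#print axioms Summit.HodgeConjecture.HodgeConjecture.Ring2.SemiregularRepresentatives.hc_av_of_exceptionalRegimeAt_twisted_diagonal_frequently

end Summit.HodgeConjecture.HodgeConjecture.Ring2.SemiregularRepresentatives

end
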